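import Summits.AtomisticToContinuum.HydrodynamicLimit.Theorems.RelayRaceLocalityLightConeInLawSketchLine
import Summits.AtomisticToContinuum.HydrodynamicLimit.Theorems.DenseExcursion.Negative.AthermalScaling
import Literature.MathematicalPhysics.KineticTheory.HardSphereEulerClassicalUniqueness
import Literature.MathematicalPhysics.KineticTheory.HardSphereEulerSolutionGluing

/-!
# Stubs `hsEuler_restrict` and `hsEuler_rescale` of the line `Sketch` for the crux `LightConeInLaw`
(stmt-AtomisticToContinuum-12500; route `RelayRaceLocality`, sub-problem `HydrodynamicLimit`;
DoD leg of the sandwich `stub_core ⇐ HL-general ∧ DoD`)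

Two soft facts about classical hard-sphere Euler solutions `IsHardSphereEulerSolution σ T ρ u θ`
(`ρ, u, θ` jointly smooth on `[0, T) × 𝕋³`, `ρ, θ > 0`, the three conservation laws pointwise on
`[0, T) × 𝕋³` with one-sided time derivatives `Torus.timeDerivWithin (Ico 0 T)` and pressure
`hsPressure σ ρ θ = ρ θ Z(ρσ³)`), used by the finite-domain-of-dependence argument in REDUCED units:

* `hsEuler_restrict` — a classical solution on `[0, T)` is a classical solution on `[0, T')` for
  every `T' ≤ T` (the registered signature; it is the tree lemma
  `IsHardSphereEulerSolution.restrict` of `HardSphereEulerSolutionGluing.lean`: smoothness and the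
  pointwise clauses restrict, and for `t < T' ≤ T` the one-sided time derivatives within `[0, T')`
  and `[0, T)` agree at `t`).
* `hsEuler_rescale` — passing to reduced units: if `(ρ, u, θ)` is a classical solution for the
  reduced diameter `σ > 0`, then the reduced triple `(ρσ³, u, θ)` is a classical solution for the
  reduced diameter `1` on the same time interval. Indeed `p₁(ρσ³, θ) = ρσ³ θ Z(ρσ³ · 1³) = σ³ p_σ(ρ, θ)`
  and `E(ρσ³, u, θ) = σ³ E(ρ, u, θ)`, so every conservation law of the reduced triple is `σ³` times
  the corresponding law of `(ρ, u, θ)`. The constant is pulled out of `Torus.timeDerivWithin`,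
  `Torus.partialDeriv`, `Torus.divergence` and `Torus.gradient` by the junk-safe linearity of
  Mathlib's `derivWithin` / `deriv` / `fderiv` in a constant FIELD element (no differentiability is
  needed, so nothing about the smoothness of the pressure law `hsCompressibility` enters): the
  tree lemmas `DenseExcursionAthermalScaling.{partialDeriv_const_smul, divergence_const_smul,
  gradient_const_mul}` (`DenseExcursion/Negative/AthermalScaling.lean`, the athermal scaling
  symmetry, whose density-rescaling sibling this is) and Mathlib's `derivWithin_const_mul_field`,
  `derivWithin_fun_const_smul_field` for the time derivative.

The small helpers live in the sub-namespace `DoD.Rescale` (names local to this leg).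

References: H. Spohn, *Large Scale Dynamics of Interacting Particles* (1991), Part I Ch. 3
(reduced units for the hard-sphere gas); C. M. Dafermos, *Hyperbolic Conservation Laws in
Continuum Physics* (2nd ed. 2005), Ch. V §5.1 (restriction of classical solutions).
-/

namespace Summit.AtomisticToContinuum.HydrodynamicLimit.Theorems.LightConeInLawSketch.DoD

open scoped BigOperators Topology Classical ENNReal
open Filter Set MeasureTheory
open Literature.MathematicalPhysics.KineticTheory Literature.Analysis.FluidPDE
  Literature.Analysis.FunctionSpaces

noncomputable section

namespace Rescale

/-! ### Helpers: constants pass through `∂ₜ` (junk-safe); the `σ³` scaling of `p` and `E` -/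

/-- `∂ₜ (c f) = c ∂ₜ f` within any time set, for scalar fields (no differentiability:
Mathlib `derivWithin_const_mul_field`). -/
theorem timeDerivWithin_const_mul (S : Set ℝ) (c : ℝ) (f : ℝ → T3 → ℝ) (t : ℝ) (x : T3) :
    Torus.timeDerivWithin S (fun s y => c * f s y) t x = c * Torus.timeDerivWithin S f t x :=
  derivWithin_const_mul_field c

/-- `∂ₜ (c • w) = c • ∂ₜ w` within any time set, for vector fields (no differentiability:
Mathlib `derivWithin_fun_const_smul_field`). -/
theorem timeDerivWithin_const_smul (S : Set ℝ) (c : ℝ) (w : ℝ → T3 → V3) (t : ℝ) (x : T3) :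
    Torus.timeDerivWithin S (fun s y => c • w s y) t x = c • Torus.timeDerivWithin S w t x :=
  derivWithin_fun_const_smul_field c _

/-- The hard-sphere pressure law in reduced units: `p₁(ρσ³, θ) = σ³ p_σ(ρ, θ)` (the local reduced
density `ρσ³ · 1³ = ρσ³` is unchanged). -/
theorem hsPressure_one_mul_pow (σ ρ θ : ℝ) :
    hsPressure 1 (ρ * σ ^ 3) θ = σ ^ 3 * hsPressure σ ρ θ := by
  simp only [hsPressure, one_pow, mul_one]
  ring

/-- The total energy density is linear in the density: `E(ρ c, u, θ) = c E(ρ, u, θ)`. -/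
theorem totalEnergyDensity_mul (ρ c : ℝ) (v : V3) (θ : ℝ) :
    totalEnergyDensity (ρ * c) v θ = c * totalEnergyDensity ρ v θ := by
  simp only [totalEnergyDensity]
  ring

end Rescale

/-! ### The two registered stubs -/

/-- **Restriction in time (registered stub `hsEuler_restrict`).** A classical hard-sphere Euler
solution on `[0, T)` is a classical solution on `[0, T')` for every `T' ≤ T`: joint smoothness and
the pointwise positivity clauses restrict to the smaller time set, and at `t ∈ [0, T')` the
one-sided time derivatives within `[0, T')` and `[0, T)` agree, so each conservation law on
`[0, T')` is the one on `[0, T)` (tree lemma `IsHardSphereEulerSolution.restrict`). -/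
theorem hsEuler_restrict : ∀ {σ T T' : ℝ} {ρ θ : ℝ → T3 → ℝ} {u : ℝ → T3 → V3},
    IsHardSphereEulerSolution σ T ρ u θ → T' ≤ T → IsHardSphereEulerSolution σ T' ρ u θ :=
  fun hE hT => hE.restrict hT

/-- **Reduced units (registered stub `hsEuler_rescale`).** If `(ρ, u, θ)` is a classical
hard-sphere Euler solution on `[0, T)` for the reduced diameter `σ > 0`, then the reduced triple
`(ρσ³, u, θ)` is a classical solution on `[0, T)` for the reduced diameter `1`: `ρσ³` is jointly
smooth and positive, and since `p₁(ρσ³, θ) = σ³ p_σ(ρ, θ)` (`Rescale.hsPressure_one_mul_pow`) and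
`E(ρσ³, u, θ) = σ³ E(ρ, u, θ)`, the mass, momentum and energy laws of the reduced triple are `σ³`
times those of `(ρ, u, θ)` — the constant comes out of `∂ₜ`, `∂ᵢ`, `div`, `∇` with no
differentiability requirement (`Rescale.timeDerivWithin_const_mul`, `…_const_smul`,
`DenseExcursionAthermalScaling.{partialDeriv_const_smul, divergence_const_smul,
gradient_const_mul}`). -/
theorem hsEuler_rescale : ∀ {σ T : ℝ} {ρ θ : ℝ → T3 → ℝ} {u : ℝ → T3 → V3}, 0 < σ →
    IsHardSphereEulerSolution σ T ρ u θ →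
    IsHardSphereEulerSolution 1 T (fun t x => ρ t x * σ ^ 3) u θ := by
  intro σ T ρ θ u hσ hE
  have hc : (0 : ℝ) < σ ^ 3 := pow_pos hσ 3
  refine ⟨hE.smooth_density.mul (Torus.isSmoothSpaceTimeOn_const (Torus.isSmooth_const (σ ^ 3)) _),
    hE.smooth_velocity, hE.smooth_temperature,
    fun t ht x => mul_pos (hE.density_pos t ht x) hc, hE.temperature_pos,
    fun t ht x => ?_, fun t ht x => ?_, fun t ht x => ?_⟩
  · -- mass: `∂ₜ(σ³ρ) + div(σ³ρ u) = σ³ (∂ₜρ + div(ρu))`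
    have h1 : (fun s y => ρ s y * σ ^ 3) = fun s y => σ ^ 3 * ρ s y := by
      funext s y; ring
    have h2 : (fun y => (ρ t y * σ ^ 3) • u t y) = fun y => σ ^ 3 • (ρ t y • u t y) := by
      funext y; rw [smul_smul, mul_comm]
    rw [h1, h2, Rescale.timeDerivWithin_const_mul,
      DenseExcursionAthermalScaling.divergence_const_smul, ← mul_add, hE.mass t ht x, mul_zero]
  · -- momentum: every term is `σ³ •` the corresponding term of the original law
    have h1 : (fun s y => (ρ s y * σ ^ 3) • u s y) = fun s y => σ ^ 3 • (ρ s y • u s y) := by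
      funext s y; rw [smul_smul, mul_comm]
    have h2 : ∀ i : Fin 3, (fun y => (ρ t y * σ ^ 3 * u t y i) • u t y) =
        fun y => σ ^ 3 • ((ρ t y * u t y i) • u t y) := by
      intro i; funext y; rw [smul_smul]; congr 1; ring
    have h3 : (fun y => hsPressure 1 (ρ t y * σ ^ 3) (θ t y)) =
        fun y => σ ^ 3 * hsPressure σ (ρ t y) (θ t y) := by
      funext y; exact Rescale.hsPressure_one_mul_pow σ _ _
    have h4 : (∑ i, Torus.partialDeriv i (fun y => (ρ t y * σ ^ 3 * u t y i) • u t y) x) =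
        σ ^ 3 • ∑ i, Torus.partialDeriv i (fun y => (ρ t y * u t y i) • u t y) x := by
      rw [Finset.smul_sum]
      exact Finset.sum_congr rfl fun i _ => by
        rw [h2 i, DenseExcursionAthermalScaling.partialDeriv_const_smul]
    rw [h1, h3, h4, Rescale.timeDerivWithin_const_smul,
      DenseExcursionAthermalScaling.gradient_const_mul, ← smul_add, ← smul_add,
      hE.momentum t ht x, smul_zero]
  · -- energy: `E' = σ³ E`, `E' + p' = σ³ (E + p)`
    have h1 : (fun s y => totalEnergyDensity (ρ s y * σ ^ 3) (u s y) (θ s y)) =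
        fun s y => σ ^ 3 * totalEnergyDensity (ρ s y) (u s y) (θ s y) := by
      funext s y; exact Rescale.totalEnergyDensity_mul _ _ _ _
    have h2 : (fun y => (totalEnergyDensity (ρ t y * σ ^ 3) (u t y) (θ t y) +
          hsPressure 1 (ρ t y * σ ^ 3) (θ t y)) • u t y) =
        fun y => σ ^ 3 • ((totalEnergyDensity (ρ t y) (u t y) (θ t y) +
          hsPressure σ (ρ t y) (θ t y)) • u t y) := by
      funext y
      rw [Rescale.totalEnergyDensity_mul, Rescale.hsPressure_one_mul_pow, ← mul_add, smul_smul]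
    rw [h1, h2, Rescale.timeDerivWithin_const_mul,
      DenseExcursionAthermalScaling.divergence_const_smul, ← mul_add, hE.energy t ht x, mul_zero]

end

end Summit.AtomisticToContinuum.HydrodynamicLimit.Theorems.LightConeInLawSketch.DoD
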